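import Literature.MathematicalPhysics.QuantumFieldTheory.Balaban1983to89.B7TranslationCovariance

/-!
# `Balaban1983to89.B7AvgPeriodicity` — PERIODISATION DICTIONARY for the `ℤ^d` objects of [Balaban1985Averaging]: periodic
configurations stay periodic through the levels (period `L^jT` on the fine lattice ⟹ period `T` on the `j`-th lattice) and descend to
the discrete torus `(ℤ/Tℤ)^d` of [Balaban1987RG1] (0.1) — PROVED

HONEST FRAMING (cell `lit-balaban`, verbatim): statement-level skeleton of published theorems with citation tags; proofs where
landed; nothing here is a claim about the Yang–Mills mass gap.

CITATION HEADER.  T. Bałaban, *Renormalization group approach to lattice gauge field theories. I*, Commun. Math. Phys. **109** (1987)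
249–301 [Balaban1987RG1] (cell paper B12; journal page = PDF page + 248), (0.1) p. 251: «a torus T obtained by the usual identification of
boundary points of the cube {x ∈ R^d : −L_μ ≤ x_μ ≤ L_μ}», «L_μ = L^m», `T_ε = {x ∈ εℤ^d + Σ ε/2 e_μ : −L_μ ≤ x_μ < L_μ}`, «This torus
determines a sequence of tori T^{(k)}_{L^kε}»; T. Bałaban, *Averaging operations for lattice gauge theories*, Commun. Math. Phys. **98**
(1985) 17–51 [Balaban1985Averaging] (cell paper B7), (43) p. 24, (127) p. 37, p. 19 («`Ω^{(j)}` may be replaced by any other lattice»).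
Unit `lit-balaban-r20` gen 4; a SUPPLEMENT to `B7TranslationCovariance` (p247411) answering the NE9 owner's NEED-3 (c) (HOME/INBOX
2026-08-21T03:5xZ: «either object's TORUS twin or a periodisation dictionary line (row NE9 reads on torus carriers; (M1) of
`B11Eq7Convention` declares ℤ^d)»).  No row head claimed (B7 owner r04).

THE DICTIONARY.  A field configuration on the discrete torus of (0.1) with `N = 2L^m/ε` points a side is the same thing as an
`N`-PERIODIC configuration on `ℤ^d` (periodic in every coordinate direction, equivalently under the period lattice `Nℤ^d`,
`periodic_of_coord`).  By the joint translation covariance of `B7TranslationCovariance`, the `j`-fold averages (43) and the composites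
`Q_j(U₀, B)` (127) of `L^jT`-periodic data are `T`-periodic on the `j`-th lattice (`avgIter_periodic`, `logCovIter_periodic`,
`linCovIter_periodic`; one step: `Qcov_periodic`), hence DESCEND to functions on the torus `Fin d → ZMod T` (`descend`, `descend_proj`:
`descend T f (proj T z) = f z` for `T`-periodic `f`; `logCovIter_descend`).  So the torus twins of the lineage's `ℤ^d` objects are their
descents, and every bondwise identity/bound proved on `ℤ^d` for periodic data holds verbatim on the torus.

WHAT THIS FILE PROVES (kernel, 0 sorry, standard axioms; definitions `proj`, `torusLift`, `descend`; no `def … : Prop`): §1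
`shiftCfg_add`, `shiftCfg_neg_of_invariant`, `shiftCfg_zsmul_of_invariant`, `shiftCfg_sum_of_invariant`, `smul_eq_sum_coord`,
`periodic_of_coord`; §2 `avgIter_periodic`, `logCovIter_periodic`, `linCovIter_periodic`, `Qcov_periodic`; §3 `proj`, `torusLift`,
`proj_torusLift`, `torusLift_proj`, `descend`, `descend_proj`, `logCovIter_descend`.

DIVERGENCES / NOT PROVED.  The identification of the print's `T_ε` (half-integer offsets, side `2L^m`) with `Fin d → ZMod N` is the
usual relabelling, not spelled out; nothing analytic is claimed here.
-/

noncomputable section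

open scoped BigOperators
open Literature.MathematicalPhysics.QuantumFieldTheory.Balaban1983to89
open Literature.MathematicalPhysics.QuantumFieldTheory.Balaban1983to89.B7Prop1Explicit (e)
open Literature.MathematicalPhysics.QuantumFieldTheory.Balaban1983to89.B7Prop2Explicit (avgIter)
open Literature.MathematicalPhysics.QuantumFieldTheory.Balaban1983to89.B7Prop3GeneralLinear (Qcov)
open Literature.MathematicalPhysics.QuantumFieldTheory.Balaban1983to89.B7Prop4GeneralLevels (logCovIter linCovIter)
open Literature.MathematicalPhysics.QuantumFieldTheory.Balaban1983to89.B12Ineq417Flat (shiftCfg shiftCfg_apply shiftCfg_zero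
  shiftCfg_shiftCfg)
open Literature.MathematicalPhysics.QuantumFieldTheory.Balaban1983to89.B7TranslationCovariance (shiftCfg_avgIter logCovIter_shiftCfg
  linCovIter_shiftCfg Qcov_shiftCfg)

namespace Literature.MathematicalPhysics.QuantumFieldTheory.Balaban1983to89.B7AvgPeriodicity

variable {d : ℕ}

/-! ## §1 Periods: from one translation to its multiples, from the coordinate periods to the period lattice -/

section Periods

variable {β : Type*}

/-- `t_{a+b} = t_a ∘ t_b`. [cite: Balaban1987RG1, (4.16) p.285] (elementary API; our proof) -/
theorem shiftCfg_add (a b : B7Prop1Explicit.Site d) (F : B7Prop1Explicit.Site d → β) :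
    shiftCfg (a + b) F = shiftCfg a (shiftCfg b F) := (shiftCfg_shiftCfg a b F).symm

/-- Invariance under `t_a` gives invariance under `t_{−a}`. [cite: Balaban1987RG1, (0.1) p.251] (elementary API; our proof) -/
theorem shiftCfg_neg_of_invariant {a : B7Prop1Explicit.Site d} {F : B7Prop1Explicit.Site d → β} (h : shiftCfg a F = F) :
    shiftCfg (-a) F = F := by
  conv_lhs => rw [← h]
  rw [shiftCfg_shiftCfg, neg_add_cancel, shiftCfg_zero]

/-- Invariance under `t_a` gives invariance under every `t_{na}`, `n ∈ ℤ`. [cite: Balaban1987RG1, (0.1) p.251] (elementary API; our proof) -/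
theorem shiftCfg_zsmul_of_invariant {a : B7Prop1Explicit.Site d} {F : B7Prop1Explicit.Site d → β} (h : shiftCfg a F = F) :
    ∀ n : ℤ, shiftCfg (n • a) F = F := by
  intro n
  induction n using Int.induction_on with
  | zero => simp
  | succ n ih => rw [add_smul, one_smul, shiftCfg_add, h, ih]
  | pred n ih => rw [sub_smul, one_smul, sub_eq_add_neg, shiftCfg_add, shiftCfg_neg_of_invariant h, ih]

/-- Invariance under each `t_{v_i}` gives invariance under `t_{Σ v_i}`. [cite: Balaban1987RG1, (0.1) p.251] (elementary API; our proof) -/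
theorem shiftCfg_sum_of_invariant {ι : Type*} (s : Finset ι) (v : ι → B7Prop1Explicit.Site d) {F : B7Prop1Explicit.Site d → β}
    (h : ∀ i ∈ s, shiftCfg (v i) F = F) : shiftCfg (∑ i ∈ s, v i) F = F := by
  classical
  induction s using Finset.induction_on with
  | empty => simp
  | insert i s hi ih =>
    rw [Finset.sum_insert hi, shiftCfg_add, ih fun k hk => h k (Finset.mem_insert_of_mem hk),
      h i (Finset.mem_insert_self i s)]

/-- `T·a = Σ_i a_i·(T e_i)` on `ℤ^d`. [cite: Balaban1987RG1, (0.1) p.251] (elementary API; our proof) -/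
theorem smul_eq_sum_coord (T : ℤ) (a : B7Prop1Explicit.Site d) : T • a = ∑ i : Fin d, (a i) • (T • e i) := by
  funext k
  simp only [Pi.smul_apply, smul_eq_mul, Finset.sum_apply, e, Pi.single_apply, mul_ite, mul_one, mul_zero]
  rw [Finset.sum_ite_eq]
  simp [mul_comm]

/-- **From the coordinate periods to the period lattice**: a configuration with period `T e_i` in every coordinate direction is
invariant under the whole lattice `Tℤ^d` — the torus of (0.1) as `ℤ^d` modulo `Tℤ^d`. [cite: Balaban1987RG1, (0.1) p.251] -/
theorem periodic_of_coord {T : ℤ} {F : B7Prop1Explicit.Site d → β} (h : ∀ i : Fin d, shiftCfg (T • e i) F = F) :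
    ∀ a : B7Prop1Explicit.Site d, shiftCfg (T • a) F = F := by
  intro a
  rw [smul_eq_sum_coord]
  exact shiftCfg_sum_of_invariant _ _ fun i _ => shiftCfg_zsmul_of_invariant (h i) (a i)

end Periods

/-! ## §2 Periodicity through the levels -/

section Levels

variable {𝔸 : Type*} [NormedRing 𝔸] [NormedAlgebra ℂ 𝔸] [CompleteSpace 𝔸]

/-- **The `j`-fold average (43) of an `L^jT`-periodic configuration is `T`-periodic on the `j`-th lattice.**
[cite: Balaban1985Averaging, (43) p.24; Balaban1987RG1, (0.1) p.251] -/
theorem avgIter_periodic (L : ℕ) (U : B7Prop1Explicit.Site d → Fin d → 𝔸ˣ) (j : ℕ) {T : ℤ}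
    (hU : ∀ a : B7Prop1Explicit.Site d, shiftCfg ((((L : ℤ) ^ j) * T) • a) U = U) (a : B7Prop1Explicit.Site d) :
    shiftCfg (T • a) (avgIter L U j) = avgIter L U j := by
  rw [shiftCfg_avgIter, smul_smul, hU]

/-- **The composite `Q_j(U₀, B)` (127) of `L^jT`-periodic data is `T`-periodic on the `j`-th lattice.**
[cite: Balaban1985Averaging, (127) p.37; Balaban1987RG1, (0.1) p.251] -/
theorem logCovIter_periodic (L : ℕ) (U₀ : B7Prop1Explicit.Site d → Fin d → 𝔸ˣ) (B : B7Prop1Explicit.Site d → Fin d → 𝔸) (j : ℕ)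
    {T : ℤ} (hU : ∀ a : B7Prop1Explicit.Site d, shiftCfg ((((L : ℤ) ^ j) * T) • a) U₀ = U₀)
    (hB : ∀ a : B7Prop1Explicit.Site d, shiftCfg ((((L : ℤ) ^ j) * T) • a) B = B) (a z : B7Prop1Explicit.Site d) (κ : Fin d) :
    logCovIter L U₀ B j (z + T • a) κ = logCovIter L U₀ B j z κ := by
  rw [logCovIter_shiftCfg, smul_smul, hU, hB]

/-- **The composed linear parts `L^jηQ_j(U₀)B` of `L^jT`-periodic data are `T`-periodic on the `j`-th lattice.**
[cite: Balaban1985Averaging, (127) p.37, (150) p.40; Balaban1987RG1, (0.1) p.251] -/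
theorem linCovIter_periodic (L : ℕ) (U₀ : B7Prop1Explicit.Site d → Fin d → 𝔸ˣ) (B : B7Prop1Explicit.Site d → Fin d → 𝔸) (j : ℕ)
    {T : ℤ} (hU : ∀ a : B7Prop1Explicit.Site d, shiftCfg ((((L : ℤ) ^ j) * T) • a) U₀ = U₀)
    (hB : ∀ a : B7Prop1Explicit.Site d, shiftCfg ((((L : ℤ) ^ j) * T) • a) B = B) (a z : B7Prop1Explicit.Site d) (κ : Fin d) :
    linCovIter L U₀ B j (z + T • a) κ = linCovIter L U₀ B j z κ := by
  rw [linCovIter_shiftCfg, smul_smul, hU, hB]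

/-- **One step**: the map (121) `Q(V₀, A, c)` of `a`-invariant data is `a`-invariant. [cite: Balaban1985Averaging, (121) p.36] -/
theorem Qcov_periodic (L : ℕ) (V₀ : B7Prop1Explicit.Site d → Fin d → 𝔸ˣ) (A : B7Prop1Explicit.Site d → Fin d → 𝔸)
    {a : B7Prop1Explicit.Site d} (hV : shiftCfg a V₀ = V₀) (hA : shiftCfg a A = A) (q : B7Prop1Explicit.Site d) (κ : Fin d) :
    Qcov L V₀ A (q + a) κ = Qcov L V₀ A q κ := by
  rw [← Qcov_shiftCfg, hV, hA]

end Levels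

/-! ## §3 Descent to the discrete torus `(ℤ/Tℤ)^d` -/

section Torus

variable (T : ℕ) [NeZero T]

/-- The projection `ℤ^d → (ℤ/Tℤ)^d`. [cite: Balaban1987RG1, (0.1) p.251] -/
def proj (z : B7Prop1Explicit.Site d) : Fin d → ZMod T := fun i => ((z i : ℤ) : ZMod T)

/-- A section of the projection: the representative in `[0, T)^d`. [cite: Balaban1987RG1, (0.1) p.251] -/
def torusLift (w : Fin d → ZMod T) : B7Prop1Explicit.Site d := fun i => ((w i).val : ℤ)

/-- `proj ∘ torusLift = id`. [cite: Balaban1987RG1, (0.1) p.251] (elementary API; our proof) -/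
@[simp] theorem proj_torusLift (w : Fin d → ZMod T) : proj T (torusLift T w) = w := by
  funext i
  simp [proj, torusLift]

/-- `torusLift ∘ proj` moves a point by a vector of the period lattice `Tℤ^d`. [cite: Balaban1987RG1, (0.1) p.251] (elementary API; our proof) -/
theorem torusLift_proj (z : B7Prop1Explicit.Site d) :
    torusLift T (proj T z) = z + (T : ℤ) • (fun i => -(z i / (T : ℤ))) := by
  funext i
  simp only [torusLift, proj, ZMod.val_intCast, Pi.add_apply, Pi.smul_apply, smul_eq_mul]
  rw [Int.emod_def]
  ring

variable {T}

/-- **Descent of a `Tℤ^d`-periodic function on `ℤ^d` to the torus `(ℤ/Tℤ)^d`** (through the section `torusLift`).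
[cite: Balaban1987RG1, (0.1) p.251] -/
def descend (T : ℕ) [NeZero T] {X : Type*} (f : B7Prop1Explicit.Site d → X) : (Fin d → ZMod T) → X := fun w => f (torusLift T w)

/-- **The descent computes the function**: `descend T f (proj T z) = f z` for `Tℤ^d`-periodic `f`. [cite: Balaban1987RG1, (0.1) p.251] -/
theorem descend_proj {X : Type*} (f : B7Prop1Explicit.Site d → X)
    (hf : ∀ a : B7Prop1Explicit.Site d, shiftCfg ((T : ℤ) • a) f = f) (z : B7Prop1Explicit.Site d) :
    descend T f (proj T z) = f z := by
  unfold descend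
  rw [torusLift_proj]
  have h := congrFun (hf (fun i => -(z i / (T : ℤ)))) z
  rwa [shiftCfg_apply] at h

/-- **THE DICTIONARY LINE FOR `Q_j(U₀, B)`**: for `L^jT`-periodic `(U₀, B)` on `ℤ^d` the composite averaging (127) on the `j`-th
lattice is a function on the torus `(ℤ/Tℤ)^d` of [Balaban1987RG1] (0.1) — its descent agrees with it at every site.
[cite: Balaban1985Averaging, (127) p.37; Balaban1987RG1, (0.1) p.251] -/
theorem logCovIter_descend {𝔸 : Type*} [NormedRing 𝔸] [NormedAlgebra ℂ 𝔸] [CompleteSpace 𝔸] (L : ℕ)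
    (U₀ : B7Prop1Explicit.Site d → Fin d → 𝔸ˣ) (B : B7Prop1Explicit.Site d → Fin d → 𝔸) (j : ℕ)
    (hU : ∀ a : B7Prop1Explicit.Site d, shiftCfg ((((L : ℤ) ^ j) * (T : ℤ)) • a) U₀ = U₀)
    (hB : ∀ a : B7Prop1Explicit.Site d, shiftCfg ((((L : ℤ) ^ j) * (T : ℤ)) • a) B = B) (z : B7Prop1Explicit.Site d) (κ : Fin d) :
    descend T (logCovIter L U₀ B j) (proj T z) κ = logCovIter L U₀ B j z κ := by
  have hper : ∀ a : B7Prop1Explicit.Site d, shiftCfg ((T : ℤ) • a) (logCovIter L U₀ B j) = logCovIter L U₀ B j := by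
    intro a
    funext w μ
    rw [shiftCfg_apply, logCovIter_periodic L U₀ B j hU hB a w μ]
  rw [descend_proj _ hper]

end Torus

end Literature.MathematicalPhysics.QuantumFieldTheory.Balaban1983to89.B7AvgPeriodicity

end
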